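import Mathlib
import Literature.Computability.AlgebraicComplexity.GlynnMultilinearSigmaPiSigma
import Summits.ValiantsHypothesis.ValiantsHypothesis.Theorems.RigidityForcesSymmetryRankRigidMinimalReprStubLevelBoundBlocks
import Summits.ValiantsHypothesis.ValiantsHypothesis.Theorems.RigidityForcesSymmetryRankRigidMinimalReprTripleBlockDefs

/-!
# Level count with THREE tied columns (crux `RankRigidMinimalRepr`, stmt-ValiantsHypothesis-18034) — part 1: blocks

Route `ValiantsHypothesis/RigidityForcesSymmetry`, crux `RankRigidMinimalRepr` (stmt-ValiantsHypothesis-18034).  Sequel of the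
landed stub `stub_levelBound` (two tied columns, `…StubLevelBound.lean`): the same block method one rung up, for the tie
`k = 2` of `TiedLevelDecomposable` (columns `0, 1, 2` tied).  Part 2 (`…LevelBoundThreeTied.lean`) proves
`levelBound_threeTied : ∀ m ≥ 3, ∀ s w, 1 ≤ s → s + 1 ≤ m → TiedLevelDecomposable m 2 s w → m.choose s ≤ w`;
this file provides the block lemmas (vocabulary `tau₃` of `…TripleBlockDefs.lean`):
1. (`symm_mem_iff_of_mem_support₃`, `ct_eq_of_mem_support₃`) what a polynomial tied-typed for `k = 2` sees on the
   `3 × 3 × 3` block of `σ` (`p, q, r = σ⁻¹ 0, σ⁻¹ 1, σ⁻¹ 2`): `σ⁻¹ j ∈ I ↔ c j = 1` for untied `j`, and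
   `ct = [p ∈ I] + [q ∈ I] + [r ∈ I]`;
2. (`block_isSlice₃`) if `I` separates `{p, q, r}` (neither all in nor all out), the block of `P · Q` for `P`, `Q`
   tied-typed on `I`, `Iᶜ` is a SLICE along the position of the isolated row (unique factorisation,
   `coeff_graphMonomial_mul_of_isTiedTyped`);
3. (`card_tiedPatterns₃_*`) the tied-column patterns `E ⊆ {0,1,2}` of size `k`: three for `k ∈ {1, 2}`, at most one
   otherwise.

HONEST FRAMING: helper lemmas for an UNREGISTERED sequel of a registered stub (the line `PairTiedTorusBound` registers
`k = 1` only); nothing here bears on `VP ≠ VNP`.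
-/

set_option autoImplicit false

-- the mandated summit-side namespace repeats a component by design (single-problem summit)
set_option linter.dupNamespace false

open MvPolynomial Finset
open Literature.Computability.AlgebraicComplexity
open Summit.ValiantsHypothesis.ValiantsHypothesis.Theorems.RigidityForcesSymmetryPairTiedTorusBound

namespace Summit.ValiantsHypothesis.ValiantsHypothesis.Theorems.RigidityForcesSymmetryRankRigidMinimalRepr

noncomputable section

open scoped Classical

variable {n : ℕ}

/-! ### §1 What a typed polynomial sees on a `3 × 3 × 3` block (tie `k = 2`) -/

/-- Untied columns: if the row part over `I` of a block monomial of `σ` lies in the support of a polynomial typed by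
`(I, c, ct)` for the tie `k = 2`, then `σ⁻¹ j ∈ I ↔ c j = 1` for every untied column `j` (`2 < j`). -/
theorem symm_mem_iff_of_mem_support₃ {I : Finset (Fin (n + 3))} {c : Fin (n + 3) → ℕ} {ct : ℕ}
    {P : MvPolynomial (Fin (n + 3) × Fin (n + 3)) ℂ} (hP : IsTiedTyped (n + 3) 2 I c ct P)
    (σ : Equiv.Perm (Fin (n + 3))) {a₁ a₂ a₃ : Fin (n + 3)} (h₁ : a₁.val ≤ 2) (h₂ : a₂.val ≤ 2)
    (h₃ : a₃.val ≤ 2) (hmem : graphMonomialOn I (tau₃ σ a₁ a₂ a₃) ∈ P.support) {j : Fin (n + 3)}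
    (hj : 2 < j.val) : σ.symm j ∈ I ↔ c j = 1 := by
  have h2 := (hP _ hmem).2.1 j hj
  rw [sum_graphMonomialOn_col] at h2
  have hfilter : (I.filter fun i => tau₃ σ a₁ a₂ a₃ i = j) = I.filter fun i => i = σ.symm j := by
    refine Finset.filter_congr fun i _ => ?_
    rw [tau₃_eq_iff_of_untied σ h₁ h₂ h₃ hj, Equiv.eq_symm_apply]
  rw [hfilter, Finset.filter_eq'] at h2
  by_cases h : σ.symm j ∈ I
  · rw [if_pos h, Finset.card_singleton] at h2
    exact ⟨fun _ => h2.symm, fun _ => h⟩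
  · rw [if_neg h, Finset.card_empty] at h2
    refine ⟨fun h' => absurd h' h, fun h' => ?_⟩
    omega

/-- Tied total: in the same situation `ct = [p ∈ I] + [q ∈ I] + [r ∈ I]`. -/
theorem ct_eq_of_mem_support₃ {I : Finset (Fin (n + 3))} {c : Fin (n + 3) → ℕ} {ct : ℕ}
    {P : MvPolynomial (Fin (n + 3) × Fin (n + 3)) ℂ} (hP : IsTiedTyped (n + 3) 2 I c ct P)
    (σ : Equiv.Perm (Fin (n + 3))) {a₁ a₂ a₃ : Fin (n + 3)} (h₁ : a₁.val ≤ 2) (h₂ : a₂.val ≤ 2)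
    (h₃ : a₃.val ≤ 2) (hmem : graphMonomialOn I (tau₃ σ a₁ a₂ a₃) ∈ P.support) :
    ct = (if σ.symm 0 ∈ I then 1 else 0) + (if σ.symm 1 ∈ I then 1 else 0) +
      (if σ.symm 2 ∈ I then 1 else 0) := by
  have h3 := (hP _ hmem).2.2
  simp_rw [sum_graphMonomialOn_col] at h3
  rw [Finset.sum_card_fiberwise_eq_card_filter] at h3
  have hfilter : (I.filter fun i => tau₃ σ a₁ a₂ a₃ i ∈ Finset.univ.filter (fun j : Fin (n + 3) => j.val ≤ 2)) =
      I.filter fun i => i = σ.symm 0 ∨ i = σ.symm 1 ∨ i = σ.symm 2 := by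
    refine Finset.filter_congr fun i _ => ?_
    rw [Finset.mem_filter, tau₃_val_le_two_iff σ h₁ h₂ h₃]
    simp
  rw [hfilter, Finset.filter_or, Finset.filter_or, Finset.filter_eq', Finset.filter_eq', Finset.filter_eq'] at h3
  rw [← h3]
  have d01 := symm_zero_ne_symm_one₃ σ
  have d02 := symm_zero_ne_symm_two₃ σ
  have d12 := symm_one_ne_symm_two₃ σ
  by_cases hp : σ.symm 0 ∈ I <;> by_cases hq : σ.symm 1 ∈ I <;> by_cases hr : σ.symm 2 ∈ I <;>
    simp [hp, hq, hr, d01, d02, d12, d01.symm]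

/-! ### §2 The block of a separating product is a slice -/

/-- **Slices.**  If `P`, `Q` are tied-typed on complementary rows `I`, `Iᶜ` and `I` SEPARATES `{p, q, r}`
(`p = σ⁻¹ 0`, `q = σ⁻¹ 1`, `r = σ⁻¹ 2`; neither all three in `I` nor all three off `I`), then the block
`(a, b, e) ↦ coeff_{σ[p ↦ a, q ↦ b, r ↦ e]} (P · Q)` is a SLICE along the position of the row that `I` isolates: a product
of a function of that coordinate and a function of the other two (unique factorisation: the row part on the side of the
isolated row sees only its coordinate). -/
theorem block_isSlice₃ {k : ℕ} {I : Finset (Fin (n + 3))} {c c' : Fin (n + 3) → ℕ} {ct ct' : ℕ}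
    {P Q : MvPolynomial (Fin (n + 3) × Fin (n + 3)) ℂ} (hP : IsTiedTyped (n + 3) k I c ct P)
    (hQ : IsTiedTyped (n + 3) k Iᶜ c' ct' Q) (σ : Equiv.Perm (Fin (n + 3)))
    (h3 : ¬ (σ.symm 0 ∈ I ∧ σ.symm 1 ∈ I ∧ σ.symm 2 ∈ I))
    (h0 : ¬ (σ.symm 0 ∉ I ∧ σ.symm 1 ∉ I ∧ σ.symm 2 ∉ I)) :
    ∃ i : Fin 3, ∃ φ : Fin (n + 3) → ℂ, ∃ Ψ : Fin (n + 3) → Fin (n + 3) → ℂ, ∀ a b e : Fin (n + 3),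
      coeff (graphMonomial (tau₃ σ a b e)) (P * Q) =
        (if i = 0 then φ a * Ψ b e else if i = 1 then φ b * Ψ a e else φ e * Ψ a b) := by
  simp only [coeff_graphMonomial_mul_of_isTiedTyped hP hQ]
  -- independence of a row part from the coordinates of rows on the other side
  have indI : ∀ a b e a' b' e' : Fin (n + 3), (σ.symm 0 ∈ I → a = a') → (σ.symm 1 ∈ I → b = b') →
      (σ.symm 2 ∈ I → e = e') → graphMonomialOn I (tau₃ σ a b e) = graphMonomialOn I (tau₃ σ a' b' e') := by
    intro a b e a' b' e' ha hb he
    refine graphMonomialOn_congr fun i hi => ?_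
    by_cases i0 : i = σ.symm 0
    · rw [i0, tau₃_apply_symm_zero, tau₃_apply_symm_zero, ha (i0 ▸ hi)]
    by_cases i1 : i = σ.symm 1
    · rw [i1, tau₃_apply_symm_one, tau₃_apply_symm_one, hb (i1 ▸ hi)]
    by_cases i2 : i = σ.symm 2
    · rw [i2, tau₃_apply_symm_two, tau₃_apply_symm_two, he (i2 ▸ hi)]
    rw [tau₃_apply_of_ne σ a b e i0 i1 i2, tau₃_apply_of_ne σ a' b' e' i0 i1 i2]
  have indIc : ∀ a b e a' b' e' : Fin (n + 3), (σ.symm 0 ∉ I → a = a') → (σ.symm 1 ∉ I → b = b') →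
      (σ.symm 2 ∉ I → e = e') → graphMonomialOn Iᶜ (tau₃ σ a b e) = graphMonomialOn Iᶜ (tau₃ σ a' b' e') := by
    intro a b e a' b' e' ha hb he
    refine graphMonomialOn_congr fun i hi => ?_
    rw [Finset.mem_compl] at hi
    by_cases i0 : i = σ.symm 0
    · rw [i0, tau₃_apply_symm_zero, tau₃_apply_symm_zero, ha (i0 ▸ hi)]
    by_cases i1 : i = σ.symm 1
    · rw [i1, tau₃_apply_symm_one, tau₃_apply_symm_one, hb (i1 ▸ hi)]
    by_cases i2 : i = σ.symm 2
    · rw [i2, tau₃_apply_symm_two, tau₃_apply_symm_two, he (i2 ▸ hi)]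
    rw [tau₃_apply_of_ne σ a b e i0 i1 i2, tau₃_apply_of_ne σ a' b' e' i0 i1 i2]
  by_cases hp : σ.symm 0 ∈ I <;> by_cases hq : σ.symm 1 ∈ I <;> by_cases hr : σ.symm 2 ∈ I
  · exact absurd ⟨hp, hq, hr⟩ h3
  · -- `I ∩ {p,q,r} = {p,q}`: slice along the third position
    refine ⟨2, fun e => coeff (graphMonomialOn Iᶜ (tau₃ σ 0 0 e)) Q,
      fun a b => coeff (graphMonomialOn I (tau₃ σ a b 0)) P, fun a b e => ?_⟩
    simp only [Fin.isValue, show (2 : Fin 3) ≠ 0 by decide, show (2 : Fin 3) ≠ 1 by decide, if_false]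
    rw [indI a b e a b 0 (fun _ => rfl) (fun _ => rfl) (fun h => absurd h hr),
      indIc a b e 0 0 e (fun h => absurd hp h) (fun h => absurd hq h) (fun _ => rfl), mul_comm]
  · -- `{p, r}`: slice along the second position
    refine ⟨1, fun b => coeff (graphMonomialOn Iᶜ (tau₃ σ 0 b 0)) Q,
      fun a e => coeff (graphMonomialOn I (tau₃ σ a 0 e)) P, fun a b e => ?_⟩
    simp only [Fin.isValue, show (1 : Fin 3) ≠ 0 by decide, if_false, if_true]
    rw [indI a b e a 0 e (fun _ => rfl) (fun h => absurd h hq) (fun _ => rfl),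
      indIc a b e 0 b 0 (fun h => absurd hp h) (fun _ => rfl) (fun h => absurd hr h), mul_comm]
  · -- `{p}`: slice along the first position
    refine ⟨0, fun a => coeff (graphMonomialOn I (tau₃ σ a 0 0)) P,
      fun b e => coeff (graphMonomialOn Iᶜ (tau₃ σ 0 b e)) Q, fun a b e => ?_⟩
    simp only [Fin.isValue, if_true]
    rw [indI a b e a 0 0 (fun _ => rfl) (fun h => absurd h hq) (fun h => absurd h hr),
      indIc a b e 0 b e (fun h => absurd hp h) (fun _ => rfl) (fun _ => rfl)]
  · -- `{q, r}`: slice along the first position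
    refine ⟨0, fun a => coeff (graphMonomialOn Iᶜ (tau₃ σ a 0 0)) Q,
      fun b e => coeff (graphMonomialOn I (tau₃ σ 0 b e)) P, fun a b e => ?_⟩
    simp only [Fin.isValue, if_true]
    rw [indI a b e 0 b e (fun h => absurd h hp) (fun _ => rfl) (fun _ => rfl),
      indIc a b e a 0 0 (fun _ => rfl) (fun h => absurd hq h) (fun h => absurd hr h), mul_comm]
  · -- `{q}`: slice along the second position
    refine ⟨1, fun b => coeff (graphMonomialOn I (tau₃ σ 0 b 0)) P,
      fun a e => coeff (graphMonomialOn Iᶜ (tau₃ σ a 0 e)) Q, fun a b e => ?_⟩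
    simp only [Fin.isValue, show (1 : Fin 3) ≠ 0 by decide, if_false, if_true]
    rw [indI a b e 0 b 0 (fun h => absurd h hp) (fun _ => rfl) (fun h => absurd h hr),
      indIc a b e a 0 e (fun _ => rfl) (fun h => absurd hq h) (fun _ => rfl)]
  · -- `{r}`: slice along the third position
    refine ⟨2, fun e => coeff (graphMonomialOn I (tau₃ σ 0 0 e)) P,
      fun a b => coeff (graphMonomialOn Iᶜ (tau₃ σ a b 0)) Q, fun a b e => ?_⟩
    simp only [Fin.isValue, show (2 : Fin 3) ≠ 0 by decide, show (2 : Fin 3) ≠ 1 by decide, if_false]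
    rw [indI a b e 0 0 e (fun h => absurd h hp) (fun h => absurd h hq) (fun _ => rfl),
      indIc a b e a b 0 (fun _ => rfl) (fun _ => rfl) (fun h => absurd hr h)]
  · exact absurd ⟨hp, hq, hr⟩ h0

/-! ### §3 Tied-column patterns of a given size -/

/-- The tied-column patterns `E ⊆ {0, 1, 2}` (as triples of Booleans) of a given size `k ∉ {1, 2}`: at most one. -/
theorem card_tiedPatterns₃_le_one (k : ℕ) (hk1 : k ≠ 1) (hk2 : k ≠ 2) :
    ((Finset.univ : Finset (Bool × Bool × Bool)).filter (fun e =>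
      (if e.1 then 1 else 0) + (if e.2.1 then 1 else 0) + (if e.2.2 then 1 else 0) = k)).card ≤ 1 := by
  refine Finset.card_le_one.2 fun a ha b hb => ?_
  rw [Finset.mem_filter] at ha hb
  obtain ⟨a1, a2, a3⟩ := a
  obtain ⟨b1, b2, b3⟩ := b
  cases a1 <;> cases a2 <;> cases a3 <;> cases b1 <;> cases b2 <;> cases b3 <;> simp_all <;> omega

/-- The tied-column patterns of size `1`: three. -/
theorem card_tiedPatterns₃_one :
    ((Finset.univ : Finset (Bool × Bool × Bool)).filter (fun e =>
      (if e.1 then 1 else 0) + (if e.2.1 then 1 else 0) + (if e.2.2 then 1 else 0) = 1)).card ≤ 3 := by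
  decide

/-- The tied-column patterns of size `2`: three. -/
theorem card_tiedPatterns₃_two :
    ((Finset.univ : Finset (Bool × Bool × Bool)).filter (fun e =>
      (if e.1 then 1 else 0) + (if e.2.1 then 1 else 0) + (if e.2.2 then 1 else 0) = 2)).card ≤ 3 := by
  decide


end

end Summit.ValiantsHypothesis.ValiantsHypothesis.Theorems.RigidityForcesSymmetryRankRigidMinimalRepr
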